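import Literature.MathematicalPhysics.QuantumFieldTheory.Balaban1983to89.B9Ineq349SiteReading
import Literature.MathematicalPhysics.QuantumFieldTheory.Balaban1983to89.B6Ineq288MultiLevelTorus

/-!
# `Balaban1983to89.B9Ineq349SiteComposite` — T. Bałaban, *Propagators for lattice gauge theories in a background field*, Commun. Math. Phys. **99**
# (1985) 389–434 [Balaban1985BackgroundPropagators], (3.49) p. 399 with (3.25) p. 394, (3.42) p. 397, (3.48) p. 398: THE (3.25)-IN-KERNELS DICTIONARY
# DISCHARGED OVER THE BLOCKS for the GENUINE letter `P(U) = G′Q′*(Q′G′²Q′*)⁻¹Q′G′` — each site-sector (3.49) entry of `P(U)` IS DOMINATED by the plain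
# double sum over `𝔅 × 𝔅` of a (3.42)-type left kernel, the (3.48)-type kernel of `(Q′G′²Q′*)⁻¹(U)` and a (3.42)-type right kernel, by EXACT operator
# algebra (no estimate of the paper), with print's units checked

statement-level skeleton of published theorems with citation tags; proofs where landed; nothing here is a claim about the Yang–Mills mass gap

THE PRINT (p. 399 [PDF 11]): *«These theorems [3.1, 3.2] imply all the properties of the operator R … For the operator P = I − R we obtain, using again
Lemma 2.1, [|P(x, x′)|, |(DP)_μ(x, x′)|, |(PD*)_ν(x, x′)|, |(DPD*)_{μν}(x, x′)|] ≤ O(1)[1, (L^jη)⁻¹, (L^jη)⁻¹, (L^jη)⁻²](L^{j′}η)^{−d}e^{−½δ₀d(y,y′)} … (3.49)»*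
— the derivation is not displayed (cell GAPS G-B9-12, asserted-routine).  Its first, purely algebraic half is the KERNEL FORM of (3.25): with
`P = G′Q′*CQ′G′` (`C = (Q′G′²Q′*)⁻¹`), `(D^aPD*^b)(x, x′) = Σ_{y₁,y₂∈𝔅} (D^aG′Q′*)(x, y₁) C(y₁, y₂) (Q′G′D*^b)(y₂, x′)`, so each (3.49) entry is dominated by
`Σ_{y₁,y₂} K₁(y, y₁)|C(y₁, y₂)|K₃(y₂, y′)` with `K₁` the sup over `x ∈ Δ(y)` of the left factor at the test function `Q′*δ_{y₁}` and `K₃` the sup over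
`x′ ∈ Δ(y′)` of the right factor — g0's located hypothesis shapes `B9Ineq349.CompDominated` ∕ `ObservedBy` (p461761, p477025).  dag-n06-i
`ROW25-LOCATED.md` (O2): at the β-read geometry `geo9Y` (sites = index bonds) that domination cannot be stated over the geometry's sites (blocks outside
the range of `β`); over the BLOCKS `𝔅` themselves it is exact algebra — this file.

WHAT IS PROVED (sorry-free; the non-abelian fibre `𝔸` is any complete normed ℂ-algebra; NO estimate of the paper).
* §1 tools: `deltaY_smul'`, `sum_deltaY'` (a block function is the sum of its deltas), ★ `norm_le_norm_mul_of_ball` (a ℂ-homogeneous map bounded by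
  `c` on the unit ball is bounded by `‖G‖·c` at `G` — the scaling `G = ‖G‖•(G∕‖G‖)`; no finite-dimensionality, no supremum), the covariant
  differences as ℂ-linear maps `cdSL ∕ cdsSL`, `supBlkS_le ∕ supBlkS'_le` (block sups from pointwise bounds).
* §2 ★★ `norm_apply_P349Y_le` — THE THREE-FACTOR DOMINATION, EXACT: for every ℂ-linear `𝔸`-valued functional `Λ` of site functions (evaluation at
  `x`, or `∇_{U,μ}` then evaluation), every input `φ` (a delta `δ_{x′}⊗E`, or `∇*_{U,ν}` of one) and nonnegative block kernels `ℒ, 𝒳, ℛ` bounding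
  `‖Λ(G′_UQ′*_U(δ_{y₁}⊗F))‖ ≤ ℒ(y₁)` (`‖F‖ ≤ 1`), `‖((Q′G′²Q′*)⁻¹_U(δ_{y₂}⊗F))(y₁)‖ ≤ 𝒳(y₁, y₂)`, `‖(Q′_UG′_Uφ)(y₂)‖ ≤ ℛ(y₂)`:
  `‖Λ(P(U)φ)‖ ≤ Σ_{y₁,y₂} ℒ(y₁)𝒳(y₁,y₂)ℛ(y₂)` — for def-Y's GENUINE `P349Y i parS Gp U` (`B9Ineq349SiteReading.P349Y_eq_comp`).
* §3 the BLOCK-COMPLETE input schemas at one configuration, print's units (`η = L^{−k}`, `ℓ(y) = Lʲη` and `d_T` of [4]'s torus geometry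
  `B6Ineq288MultiLevelTorus.geoBT (toKT i)`), all POINTWISE over the block's sites:
  `Left342At` — (3.42) entries `|G′λ|(x) ≤ B₀(Lʲη)²e^{−δ₀d(y,y₁)}|λ|`, `|∇_UG′λ|(x) ≤ B₀Lʲη·e^{…}|λ|` AT THE TEST FUNCTIONS `λ = Q′*_U(δ_{y₁}⊗F)`
  (`supp λ ⊂ B(y₁)`; `|λ| ≤ 1` for contractive transporters), every block pair — print's Thm 3.1 (3.42) restricted to these arguments;
  `Right342At` — the same two bounds for the ADJOINT-SIDE factor `W(y₂)·(Q′_UG′_UD*^b_U(δ_{x′}⊗E))(y₂)`, `x′ ∈ B(y′)`, observed at `y′`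
  (print obtains it from (3.42) by the self-adjointness of `G′(U)` and `Q′* = W·Q′†`; LOCATED: that adjoint structure is not typed for the abstract letter
  `Gp`, so this is a separate displayed schema); `Blk348At` — (3.48) `|C(U; y₁, y₂)| ≤ B₁(L^{j₁}η)⁻⁴(L^{j₂}η)^{−d′}e^{−δ₁d(y₁,y₂)}` for def-Y's genuine `C(U) =
  CY` AT EVERY BLOCK PAIR (the knit's `t32` reads it at based blocks only).
* §4 ★★★ `fineEntryS_le_comp3_of_schemas` — THE DICTIONARY DISCHARGED: under the three schemas at `U` (`B₀, B₁ ≥ 0`), for every block pair `(y, y′)`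
  and every entry `n`, `fineEntryS i (P349Y i parS Gp) U y y′ n ≤ comp3 K₁ K₂ K₃ y y′` with the MODEL kernels `K₁(y, y₁) = B₀ℓ(y)^{p_n}e^{−δ₀d(y,y₁)}`,
  `K₂(y₁, y₂) = B₁ℓ(y₁)⁻⁴ℓ(y₂)^{−d′}e^{−δ₁d(y₁,y₂)}`, `K₃(y₂, y′) = B₀ℓ(y′)^{q_n}e^{−δ₀d(y₂,y′)}` (`p = powL`, `q = powR` of g0's `B9Ineq349`) — ALL
  POWERS OF `η` CANCEL: the reading's `η^{−(d′+#D)}`, the (3.42) prefactors `η^{(2,1)}`, the (3.48) weight `cWtY = η^{−4−d′}∕W` and the adjoint's `W`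
  multiply to `1` (kernel-checked) — the input shape of g0's three-factor power counting `B9Ineq349.comp3_kernel_pq` («using again Lemma 2.1»:
  the sibling `B9Ineq349SiteFromBlocks`).

HONEST SCOPE.  Exact finite-dimensional operator algebra and norm bookkeeping; the three schemas are HYPOTHESES (Thm 3.1 ∕ Thm 3.2-type
statements about the genuine letters, block-complete; the adjoint-side schema located above); no inequality of the paper is proved; count-neutral;
nothing continuum ∕ OS ∕ mass-gap.  Filed by dag-n06-i gen 6 (pub-ymgap N06 bundle F4, row 25); a NEW file; nothing landed is modified.
-/

namespace Literature.MathematicalPhysics.QuantumFieldTheory.Balaban1983to89.B9Ineq349SiteComposite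

open Node00
open B6KLevelCensusIndexV1 (KIdx)
open B6Geom246MultiLevelBox (bset blkOf)
open B6Ineq268MultiLevelBox (W W_pos)
open B6Prop22KLevelTorusCensusEta (nKT nKT_pos)
open B6Ineq288MultiLevelTorus (geoBT geoBT_len geoBT_dist dist_nonneg_geoBT)
open B6Cor28 (comp3)
open B9Ineq349SiteReading (dpow349 fineEntryS P349Y_eq_comp supBlkS_nonneg supBlkS'_nonneg)
open B9Eq39Adjoint (R)
open scoped Matrix

noncomputable section

variable {d ℓ : ℕ} {hd : 1 ≤ d + 1} {hL : Odd (ℓ + 1) ∧ 1 < ℓ + 1} {b₀ b₁ : ℝ} {Mstar : ℕ}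
variable {𝔸 : Type} [NormedRing 𝔸] [NormedAlgebra ℂ 𝔸] [CompleteSpace 𝔸]

/-! ## §1 Tools: deltas, the unit-ball scaling, the covariant differences as linear maps, block sups -/

section Tools

omit [CompleteSpace 𝔸] in
/-- `δ_w ⊗ (c•E) = c • (δ_w ⊗ E)`. [cite: Balaban1985BackgroundPropagators, (3.48) p.398 (kernels), bookkeeping] -/
theorem deltaY_smul' {X : Type} (w : X) (c : ℂ) (E : 𝔸) : deltaY w (c • E) = c • deltaY w E := by
  funext z
  by_cases h : z = w
  · simp [deltaY, h]
  · simp [deltaY, h]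

omit [NormedAlgebra ℂ 𝔸] [CompleteSpace 𝔸] in
/-- a function on a finite set is the sum of its deltas: `h = Σ_w δ_w ⊗ h(w)`. [cite: Balaban1985BackgroundPropagators, (3.48) p.398 (kernels), bookkeeping] -/
theorem sum_deltaY' {X : Type} [Fintype X] (h : X → 𝔸) : ∑ w, deltaY w (h w) = h := by
  classical
  funext z
  rw [Finset.sum_apply, Finset.sum_eq_single z]
  · simp [deltaY]
  · intro w _ hw; simp [deltaY, Ne.symm hw]
  · intro hz; exact absurd (Finset.mem_univ z) hz

omit [CompleteSpace 𝔸] in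
/-- ★ **THE UNIT-BALL SCALING**: a ℂ-homogeneous map `f : 𝔸 → M` bounded by `c` on the closed unit ball obeys `‖f G‖ ≤ ‖G‖·c` everywhere
(`G = ‖G‖ • (‖G‖⁻¹ • G)`; no supremum, no finite-dimensionality). [cite: Balaban1985BackgroundPropagators, (3.42) p.397 («|λ|» normalisation), bookkeeping] -/
theorem norm_le_norm_mul_of_ball {M : Type} [SeminormedAddCommGroup M] [NormedSpace ℂ M] (f : 𝔸 → M)
    (hf : ∀ (c : ℂ) (F : 𝔸), f (c • F) = c • f F) {c : ℝ} (h : ∀ F : 𝔸, ‖F‖ ≤ 1 → ‖f F‖ ≤ c) (G : 𝔸) :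
    ‖f G‖ ≤ ‖G‖ * c := by
  by_cases hG : G = 0
  · have h0 : f 0 = 0 := by simpa using hf 0 0
    rw [hG, h0, norm_zero, norm_zero, zero_mul]
  · have hn : 0 < ‖G‖ := norm_pos_iff.2 hG
    set F : 𝔸 := ((‖G‖⁻¹ : ℝ) : ℂ) • G with hF
    have hF1 : ‖F‖ ≤ 1 := by
      rw [hF, norm_smul, Complex.norm_real, Real.norm_eq_abs, abs_of_pos (inv_pos.2 hn), inv_mul_cancel₀ hn.ne']
    have hGF : G = ((‖G‖ : ℝ) : ℂ) • F := by
      rw [hF, smul_smul, ← Complex.ofReal_mul, mul_inv_cancel₀ hn.ne', Complex.ofReal_one, one_smul]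
    calc ‖f G‖ = ‖((‖G‖ : ℝ) : ℂ) • f F‖ := by rw [hGF, hf]; rw [← hGF]
      _ = ‖G‖ * ‖f F‖ := by rw [norm_smul, Complex.norm_real, Real.norm_eq_abs, abs_of_pos hn]
      _ ≤ ‖G‖ * c := mul_le_mul_of_nonneg_left (h F hF1) hn.le

variable (i : KIdx d ℓ hd hL b₀ b₁)

/-- `∇_{U,μ}` of the site sector as a ℂ-linear map. [cite: Balaban1985BackgroundPropagators, (3.3) p.390] -/
def cdSL (U : CfgY 𝔸 i) (μ : Fin (d + 1)) : (SiteY i → 𝔸) →ₗ[ℂ] (SiteY i → 𝔸) where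
  toFun := cdS i U μ
  map_add' := cdS_add i U μ
  map_smul' := cdS_smul i U μ

/-- `∇*_{U,ν}` of the site sector as a ℂ-linear map. [cite: Balaban1985BackgroundPropagators, (3.8) p.392] -/
def cdsSL (U : CfgY 𝔸 i) (ν : Fin (d + 1)) : (SiteY i → 𝔸) →ₗ[ℂ] (SiteY i → 𝔸) where
  toFun := cdsS i U ν
  map_add' := cdsS_add i U ν
  map_smul' := cdsS_smul i U ν

/-- `cdSL` applied. [cite: Balaban1985BackgroundPropagators, (3.3) p.390, bookkeeping] -/
@[simp] theorem cdSL_apply (U : CfgY 𝔸 i) (μ : Fin (d + 1)) (Φ : SiteY i → 𝔸) : cdSL i U μ Φ = cdS i U μ Φ := rfl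

/-- `cdsSL` applied. [cite: Balaban1985BackgroundPropagators, (3.8) p.392, bookkeeping] -/
@[simp] theorem cdsSL_apply (U : CfgY 𝔸 i) (ν : Fin (d + 1)) (Φ : SiteY i → 𝔸) : cdsSL i U ν Φ = cdsS i U ν Φ := rfl

omit [NormedAlgebra ℂ 𝔸] [CompleteSpace 𝔸] in
/-- a block sup is bounded by any common bound `c ≥ 0` of the norms on the block. [cite: Balaban1985BackgroundPropagators, (3.42) p.397 («x ∈ Δ(y)»), bookkeeping] -/
theorem supBlkS_le (s : BlkY i) (Ψ : SiteY i → 𝔸) {c : ℝ} (hc : 0 ≤ c) (h : ∀ z : SiteY i, blkOf i.D.toDomains z = s → ‖Ψ z‖ ≤ c) :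
    supBlkS i s Ψ ≤ c := by
  classical
  unfold supBlkS
  refine Real.iSup_le (fun z => ?_) hc
  split_ifs with hz
  · exact h z hz
  · exact hc

omit [NormedAlgebra ℂ 𝔸] [CompleteSpace 𝔸] in
/-- a directional block sup is bounded by any common bound `c ≥ 0`. [cite: Balaban1985BackgroundPropagators, (3.42) p.397, bookkeeping] -/
theorem supBlkS'_le (s : BlkY i) (Ψ : Fin (d + 1) → SiteY i → 𝔸) {c : ℝ} (hc : 0 ≤ c)
    (h : ∀ (z : SiteY i) (μ : Fin (d + 1)), blkOf i.D.toDomains z = s → ‖Ψ μ z‖ ≤ c) : supBlkS' i s Ψ ≤ c := by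
  classical
  unfold supBlkS'
  refine Real.iSup_le (fun p => ?_) hc
  split_ifs with hp
  · exact h p.1 p.2 hp
  · exact hc

end Tools

/-! ## §2 The three-factor domination for `P(U) = G′Q′*(Q′G′²Q′*)⁻¹Q′G′`, exact -/

section Composite

variable {i : KIdx d ℓ hd hL b₀ b₁} {parS : SiteParY 𝔸 i} {Gp : SiteOpY 𝔸 i} {U : CfgY 𝔸 i}

/-- ★★ **THE THREE-FACTOR DOMINATION, EXACT** (the kernel form of (3.25) behind (3.49)): for a ℂ-linear `𝔸`-valued functional `Λ` of site functions,
an input `φ`, and nonnegative block kernels with `‖Λ(G′_UQ′*_U(δ_{y₁}⊗F))‖ ≤ ℒ(y₁)` (`‖F‖ ≤ 1`), `‖((Q′G′²Q′*)⁻¹_U(δ_{y₂}⊗F))(y₁)‖ ≤ 𝒳(y₁,y₂)` (`‖F‖ ≤ 1`),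
`‖(Q′_UG′_Uφ)(y₂)‖ ≤ ℛ(y₂)`:  `‖Λ(P(U)φ)‖ ≤ Σ_{y₁,y₂∈𝔅} ℒ(y₁)·𝒳(y₁,y₂)·ℛ(y₂)`.  Proof: `P = G′Q′*∘Xinv∘Q′G′` (def-Y, `P349Y_eq_comp`), the two
intermediate block functions decomposed into their deltas, linearity, the triangle inequality and the unit-ball scaling.
[cite: Balaban1985BackgroundPropagators, (3.25) p.394 with (3.49) p.399 (the composition «G′Q′*(Q′G′²Q′*)⁻¹Q′G′» in kernels)] -/
theorem norm_apply_P349Y_le (Λ : (SiteY i → 𝔸) →ₗ[ℂ] 𝔸) (φ : SiteY i → 𝔸) (ℒ : BlkY i → ℝ) (𝒳 : BlkY i → BlkY i → ℝ) (ℛ : BlkY i → ℝ)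
    (hℒ0 : ∀ y₁, 0 ≤ ℒ y₁) (h𝒳0 : ∀ y₁ y₂, 0 ≤ 𝒳 y₁ y₂)
    (hL : ∀ (y₁ : BlkY i) (F : 𝔸), ‖F‖ ≤ 1 → ‖Λ (Gp U (QpsY i parS U (deltaY y₁ F)))‖ ≤ ℒ y₁)
    (hX : ∀ (y₁ y₂ : BlkY i) (F : 𝔸), ‖F‖ ≤ 1 → ‖XinvY i parS Gp U (deltaY y₂ F) y₁‖ ≤ 𝒳 y₁ y₂)
    (hR : ∀ y₂ : BlkY i, ‖QpY i parS U (Gp U φ) y₂‖ ≤ ℛ y₂) :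
    ‖Λ (P349Y i parS Gp U φ)‖ ≤ ∑ y₁, ∑ y₂, ℒ y₁ * 𝒳 y₁ y₂ * ℛ y₂ := by
  set g : BlkY i → 𝔸 := QpY i parS U (Gp U φ) with hg
  set h : BlkY i → 𝔸 := XinvY i parS Gp U g with hh
  -- the composite on `φ`
  have hP : P349Y i parS Gp U φ = Gp U (QpsY i parS U h) := by
    rw [P349Y_eq_comp]; rfl
  -- first decomposition: over the LEFT intermediate block `y₁`
  have hsum₁ : Λ (Gp U (QpsY i parS U h)) = ∑ y₁, Λ (Gp U (QpsY i parS U (deltaY y₁ (h y₁)))) := by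
    conv_lhs => rw [← sum_deltaY' h]
    simp only [map_sum]
  have hhom₁ : ∀ y₁ (c : ℂ) (F : 𝔸),
      Λ (Gp U (QpsY i parS U (deltaY y₁ (c • F)))) = c • Λ (Gp U (QpsY i parS U (deltaY y₁ F))) := by
    intro y₁ c F
    rw [deltaY_smul', map_smul, map_smul, map_smul]
  have step₁ : ∀ y₁, ‖Λ (Gp U (QpsY i parS U (deltaY y₁ (h y₁))))‖ ≤ ‖h y₁‖ * ℒ y₁ := fun y₁ =>
    norm_le_norm_mul_of_ball (fun F => Λ (Gp U (QpsY i parS U (deltaY y₁ F)))) (hhom₁ y₁) (hL y₁) (h y₁)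
  -- second decomposition: over the RIGHT intermediate block `y₂`
  have hsum₂ : ∀ y₁, h y₁ = ∑ y₂, XinvY i parS Gp U (deltaY y₂ (g y₂)) y₁ := by
    intro y₁
    rw [hh]
    conv_lhs => rw [← sum_deltaY' g]
    rw [map_sum, Finset.sum_apply]
  have hhom₂ : ∀ y₁ y₂ (c : ℂ) (F : 𝔸), XinvY i parS Gp U (deltaY y₂ (c • F)) y₁ = c • XinvY i parS Gp U (deltaY y₂ F) y₁ := by
    intro y₁ y₂ c F
    rw [deltaY_smul', map_smul, Pi.smul_apply]
  have step₂ : ∀ y₁, ‖h y₁‖ ≤ ∑ y₂, ‖g y₂‖ * 𝒳 y₁ y₂ := by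
    intro y₁
    rw [hsum₂ y₁]
    refine (norm_sum_le _ _).trans (Finset.sum_le_sum fun y₂ _ => ?_)
    exact norm_le_norm_mul_of_ball (fun F => XinvY i parS Gp U (deltaY y₂ F) y₁) (hhom₂ y₁ y₂) (hX y₁ y₂) (g y₂)
  -- assembly
  rw [hP, hsum₁]
  refine (norm_sum_le _ _).trans ?_
  refine Finset.sum_le_sum fun y₁ _ => ?_
  calc ‖Λ (Gp U (QpsY i parS U (deltaY y₁ (h y₁))))‖ ≤ ‖h y₁‖ * ℒ y₁ := step₁ y₁
    _ ≤ (∑ y₂, ‖g y₂‖ * 𝒳 y₁ y₂) * ℒ y₁ := mul_le_mul_of_nonneg_right (step₂ y₁) (hℒ0 y₁)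
    _ ≤ (∑ y₂, ℛ y₂ * 𝒳 y₁ y₂) * ℒ y₁ :=
        mul_le_mul_of_nonneg_right (Finset.sum_le_sum fun y₂ _ => mul_le_mul_of_nonneg_right (hR y₂) (h𝒳0 y₁ y₂)) (hℒ0 y₁)
    _ = ∑ y₂, ℒ y₁ * 𝒳 y₁ y₂ * ℛ y₂ := by rw [Finset.sum_mul]; exact Finset.sum_congr rfl fun y₂ _ => by ring

end Composite

/-! ## §3 The block-complete input schemas at one configuration, print's units -/

section Schemas

variable (i : KIdx d ℓ hd hL b₀ b₁)

/-- the scale length `ℓ(y) = Lʲη` of a block (`η = L^{−k}`; [4]'s torus geometry `geoBT`). [cite: Balaban1985BackgroundPropagators, (3.41) p.397 («Lʲη»), dictionary] -/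
def lenB (s : BlkY i) : ℝ := (geoBT (toKT i)).len s

/-- the multiscale distance `d(y, y′)` of two blocks ([4] (2.46), the torus realisation). [cite: Balaban1984PropagatorsII, (2.46) p.231, dictionary] -/
def distB (s s' : BlkY i) : ℝ := (geoBT (toKT i)).dist s s'

/-- `ℓ(y) = L^{j(y)}·η`, unfolded. [cite: Balaban1985BackgroundPropagators, (3.41) p.397, bookkeeping] -/
theorem lenB_eq (s : BlkY i) : lenB i s = ((ℓ : ℝ) + 1) ^ s.1.1 * etaS i := rfl

/-- `0 < η`. [cite: Balaban1984PropagatorsII, (2.1) p.224 («η = L^{−k}»), bookkeeping] -/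
theorem etaS_pos : 0 < etaS i := by unfold etaS; exact inv_pos.2 (by exact_mod_cast nKT_pos (toKT i))

/-- `0 < ℓ(y)`. [cite: Balaban1985BackgroundPropagators, (3.41) p.397, bookkeeping] -/
theorem lenB_pos (s : BlkY i) : 0 < lenB i s := by
  rw [lenB_eq]; exact mul_pos (pow_pos (by positivity) _) (etaS_pos i)

/-- `0 ≤ d(y, y′)`. [cite: Balaban1984PropagatorsII, (2.46) p.231, bookkeeping] -/
theorem distB_nonneg (s s' : BlkY i) : 0 ≤ distB i s s' := dist_nonneg_geoBT (toKT i) s s'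

/-- **the (3.48) weight times the block volume is `η^{−4−d′}`**: `cWtY(y)·W(y) = η^{−(4+d′)}`. [cite: Balaban1985BackgroundPropagators, (3.48) p.398; Balaban1984PropagatorsII, (2.69) p.235, bookkeeping] -/
theorem cWtY_mul_W (s : BlkY i) : cWtY i s * W i.D.toDomains s = (etaS i)⁻¹ ^ (4 + (d + 1)) := by
  unfold cWtY etaS
  rw [inv_inv, div_mul_cancel₀ _ (W_pos i.D.toDomains s).ne']

/-- `0 < cWtY(y)`. [cite: Balaban1985BackgroundPropagators, (3.48) p.398, bookkeeping] -/
theorem cWtY_pos (s : BlkY i) : 0 < cWtY i s := by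
  unfold cWtY; exact div_pos (pow_pos (by exact_mod_cast nKT_pos (toKT i)) _) (W_pos i.D.toDomains s)

variable (parS : SiteParY 𝔸 i) (Gp : SiteOpY 𝔸 i) (U : CfgY 𝔸 i)

/-- **THE LEFT (3.42) SCHEMA AT `U`, BLOCK-COMPLETE**: for all blocks `y, y₁`, all `F` in the unit ball and all `x ∈ B(y)`: `η²‖(G′_UQ′*_U(δ_{y₁}⊗F))(x)‖ ≤
B₀(Lʲη)²e^{−δ₀d(y,y₁)}` and `η‖(∇_{U,μ}G′_UQ′*_U(δ_{y₁}⊗F))(x)‖ ≤ B₀Lʲη·e^{−δ₀d(y,y₁)}` — Thm 3.1 (3.42), entries `|G′λ|`, `|∇_UG′λ|`, AT THE TEST FUNCTIONS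
`λ = Q′*(U)(δ_{y₁}⊗F)` (`supp λ ⊂ B(y₁)`).  Hypothesis schema. [cite: Balaban1985BackgroundPropagators, Thm 3.1 (3.42) p.397 with (3.25) p.394] -/
def Left342At (B₀ δ₀ : ℝ) : Prop :=
  ∀ (s s₁ : BlkY i) (F : 𝔸), ‖F‖ ≤ 1 → ∀ x : SiteY i, blkOf i.D.toDomains x = s →
    etaS i ^ 2 * ‖Gp U (QpsY i parS U (deltaY s₁ F)) x‖ ≤ B₀ * lenB i s ^ 2 * Real.exp (-(δ₀ * distB i s s₁)) ∧
      ∀ μ : Fin (d + 1), etaS i * ‖cdS i U μ (Gp U (QpsY i parS U (deltaY s₁ F))) x‖ ≤ B₀ * lenB i s * Real.exp (-(δ₀ * distB i s s₁))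

/-- **THE RIGHT (ADJOINT-SIDE) (3.42) SCHEMA AT `U`, BLOCK-COMPLETE**: for all blocks `y₂, y′`, all `x′ ∈ B(y′)`, all `E` in the unit ball:
`W(y₂)·η²‖(Q′_UG′_U(δ_{x′}⊗E))(y₂)‖ ≤ B₀(L^{j′}η)²e^{−δ₀d(y₂,y′)}` and `W(y₂)·η‖(Q′_UG′_U∇*_{U,ν}(δ_{x′}⊗E))(y₂)‖ ≤ B₀L^{j′}η·e^{−δ₀d(y₂,y′)}` — the (3.42)
bounds for the right factor `Q′G′D*^b = (D^bG′Q′*)†` observed at `y′` (print: from (3.42) by the self-adjointness of `G′(U)` and `Q′* = W·Q′†`; LOCATED — the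
adjoint structure of the abstract letter is not typed, so this is displayed separately).  Hypothesis schema.
[cite: Balaban1985BackgroundPropagators, Thm 3.1 (3.42) p.397 with (3.25) p.394, (3.49) p.399] -/
def Right342At (B₀ δ₀ : ℝ) : Prop :=
  ∀ (s₂ s' : BlkY i) (x' : SiteY i), blkOf i.D.toDomains x' = s' → ∀ E : 𝔸, ‖E‖ ≤ 1 →
    W i.D.toDomains s₂ * (etaS i ^ 2 * ‖QpY i parS U (Gp U (deltaY x' E)) s₂‖) ≤ B₀ * lenB i s' ^ 2 * Real.exp (-(δ₀ * distB i s₂ s')) ∧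
      ∀ ν : Fin (d + 1), W i.D.toDomains s₂ * (etaS i * ‖QpY i parS U (Gp U (cdsS i U ν (deltaY x' E))) s₂‖) ≤
        B₀ * lenB i s' * Real.exp (-(δ₀ * distB i s₂ s'))

/-- **THE (3.48) SCHEMA AT `U`, BLOCK-COMPLETE**: `‖(C(U)(δ_{y₂}⊗F))(y₁)‖ ≤ B₁(L^{j₁}η)⁻⁴(L^{j₂}η)^{−d′}e^{−δ₁d(y₁,y₂)}` for def-Y's genuine `C(U) = CY`
((Q′G′²Q′*)⁻¹ in print's units) at EVERY block pair (the knit's `t32` reading covers based blocks only).  Hypothesis schema.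
[cite: Balaban1985BackgroundPropagators, Thm 3.2 (3.48) p.398] -/
def Blk348At (B₁ δ₁ : ℝ) : Prop :=
  ∀ (s₁ s₂ : BlkY i) (F : 𝔸), ‖F‖ ≤ 1 →
    ‖CY i parS Gp U (deltaY s₂ F) s₁‖ ≤
      B₁ * lenB i s₁ ^ (-(4 : ℝ)) * lenB i s₂ ^ (-((d + 1 : ℕ) : ℝ)) * Real.exp (-(δ₁ * distB i s₁ s₂))

variable {i parS Gp U}

/-- the letter `C(U)` on a delta: `C(U)(δ_{y₂}⊗F) = cWtY(y₂) • (Q′G′²Q′*)⁻¹(U)(δ_{y₂}⊗F)`. [cite: Balaban1985BackgroundPropagators, (3.48) p.398, bookkeeping] -/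
theorem CY_deltaY (s₂ : BlkY i) (F : 𝔸) :
    CY i parS Gp U (deltaY s₂ F) = ((cWtY i s₂ : ℝ) : ℂ) • XinvY i parS Gp U (deltaY s₂ F) := by
  have hdiag : liftMatY 𝔸 (Matrix.diagonal (cWtY i)) (deltaY s₂ F) = deltaY s₂ (((cWtY i s₂ : ℝ) : ℂ) • F) := by
    funext s
    rw [liftMatY_apply, Finset.sum_eq_single s]
    · by_cases h : s = s₂
      · subst h; simp [deltaY, Matrix.diagonal_apply_eq]
      · simp [deltaY, h]
    · intro x _ hx; rw [Matrix.diagonal_apply_ne _ (Ne.symm hx)]; simp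
    · intro hs; exact absurd (Finset.mem_univ s) hs
  show XinvY i parS Gp U (liftMatY 𝔸 (Matrix.diagonal (cWtY i)) (deltaY s₂ F)) = _
  rw [hdiag, deltaY_smul', map_smul]

/-- the (3.48) schema in `(Q′G′²Q′*)⁻¹` form: `‖((Q′G′²Q′*)⁻¹_U(δ_{y₂}⊗F))(y₁)‖ ≤ cWtY(y₂)⁻¹·B₁ℓ(y₁)⁻⁴ℓ(y₂)^{−d′}e^{−δ₁d}`.
[cite: Balaban1985BackgroundPropagators, Thm 3.2 (3.48) p.398, bookkeeping] -/
theorem norm_XinvY_deltaY_le {B₁ δ₁ : ℝ} (h : Blk348At i parS Gp U B₁ δ₁) (s₁ s₂ : BlkY i) (F : 𝔸) (hF : ‖F‖ ≤ 1) :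
    ‖XinvY i parS Gp U (deltaY s₂ F) s₁‖ ≤
      (cWtY i s₂)⁻¹ * (B₁ * lenB i s₁ ^ (-(4 : ℝ)) * lenB i s₂ ^ (-((d + 1 : ℕ) : ℝ)) * Real.exp (-(δ₁ * distB i s₁ s₂))) := by
  have hc := cWtY_pos i s₂
  have hCY := h s₁ s₂ F hF
  rw [CY_deltaY, Pi.smul_apply, norm_smul, Complex.norm_real, Real.norm_eq_abs, abs_of_pos hc] at hCY
  rwa [← div_eq_inv_mul, le_div_iff₀ hc, mul_comm]

end Schemas

/-! ## §4 The dictionary discharged: every (3.49) entry ≤ the three-factor sum of the MODEL kernels, all powers of `η` cancelling -/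

section Discharge

variable {i : KIdx d ℓ hd hL b₀ b₁} {parS : SiteParY 𝔸 i} {Gp : SiteOpY 𝔸 i} {U : CfgY 𝔸 i}

/-- the LEFT power `p_n = (2, 1, 2, 1)` of (3.49)'s entries (`(Lʲη)²` for `G′`, `Lʲη` for `∇G′`; g0's `B9Ineq349.powL` as naturals) = the power of `η`
of the left (3.42) entry. [cite: Balaban1985BackgroundPropagators, (3.42) p.397 with (3.49) p.399] -/
def ea349 : Fin 4 → ℕ := ![2, 1, 2, 1]

/-- the RIGHT power `q_n = (2, 2, 1, 1)` (g0's `B9Ineq349.powR` as naturals). [cite: Balaban1985BackgroundPropagators, (3.42) p.397 with (3.49) p.399] -/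
def eb349 : Fin 4 → ℕ := ![2, 2, 1, 1]

/-- the unit count: `#D + p_n + q_n = 4`. [cite: Balaban1985BackgroundPropagators, (3.49) p.399, bookkeeping] -/
theorem e349_sum (n : Fin 4) : dpow349 n + ea349 n + eb349 n = 4 := by
  fin_cases n <;> rfl

/-- the model LEFT kernel `K₁(y, y₁) = B₀ℓ(y)^{p_n}e^{−δ₀d(y,y₁)}`. [cite: Balaban1985BackgroundPropagators, (3.42) p.397 with (3.49) p.399, dictionary] -/
def modelK₁ (i : KIdx d ℓ hd hL b₀ b₁) (B₀ δ₀ : ℝ) (n : Fin 4) : BlkY i → BlkY i → ℝ :=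
  fun y y₁ => B₀ * lenB i y ^ ea349 n * Real.exp (-(δ₀ * distB i y y₁))

/-- the model MIDDLE kernel `K₂(y₁, y₂) = B₁ℓ(y₁)⁻⁴ℓ(y₂)^{−d′}e^{−δ₁d(y₁,y₂)}` ((3.48)). [cite: Balaban1985BackgroundPropagators, (3.48) p.398, dictionary] -/
def modelK₂ (i : KIdx d ℓ hd hL b₀ b₁) (B₁ δ₁ : ℝ) : BlkY i → BlkY i → ℝ :=
  fun y₁ y₂ => B₁ * lenB i y₁ ^ (-(4 : ℝ)) * lenB i y₂ ^ (-((d + 1 : ℕ) : ℝ)) * Real.exp (-(δ₁ * distB i y₁ y₂))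

/-- the model RIGHT kernel `K₃(y₂, y′) = B₀ℓ(y′)^{q_n}e^{−δ₀d(y₂,y′)}`. [cite: Balaban1985BackgroundPropagators, (3.42) p.397 with (3.49) p.399, dictionary] -/
def modelK₃ (i : KIdx d ℓ hd hL b₀ b₁) (B₀ δ₀ : ℝ) (n : Fin 4) : BlkY i → BlkY i → ℝ :=
  fun y₂ y' => B₀ * lenB i y' ^ eb349 n * Real.exp (-(δ₀ * distB i y₂ y'))

/-- `K₁ ≥ 0` for `B₀ ≥ 0`. [cite: Balaban1985BackgroundPropagators, (3.42) p.397, bookkeeping] -/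
theorem modelK₁_nonneg {B₀ : ℝ} (hB₀ : 0 ≤ B₀) (δ₀ : ℝ) (n : Fin 4) (y y₁ : BlkY i) : 0 ≤ modelK₁ i B₀ δ₀ n y y₁ := by
  unfold modelK₁; have := pow_nonneg (lenB_pos i y).le (ea349 n); positivity

/-- `K₂ ≥ 0` for `B₁ ≥ 0`. [cite: Balaban1985BackgroundPropagators, (3.48) p.398, bookkeeping] -/
theorem modelK₂_nonneg {B₁ : ℝ} (hB₁ : 0 ≤ B₁) (δ₁ : ℝ) (y₁ y₂ : BlkY i) : 0 ≤ modelK₂ i B₁ δ₁ y₁ y₂ := by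
  unfold modelK₂
  have := Real.rpow_nonneg (lenB_pos i y₁).le (-(4 : ℝ))
  have := Real.rpow_nonneg (lenB_pos i y₂).le (-((d + 1 : ℕ) : ℝ))
  positivity

/-- `K₃ ≥ 0` for `B₀ ≥ 0`. [cite: Balaban1985BackgroundPropagators, (3.42) p.397, bookkeeping] -/
theorem modelK₃_nonneg {B₀ : ℝ} (hB₀ : 0 ≤ B₀) (δ₀ : ℝ) (n : Fin 4) (y₂ y' : BlkY i) : 0 ≤ modelK₃ i B₀ δ₀ n y₂ y' := by
  unfold modelK₃; have := pow_nonneg (lenB_pos i y').le (eb349 n); positivity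

/-- `comp3` of the model kernels is `≥ 0`. [cite: Balaban1985BackgroundPropagators, (3.49) p.399, bookkeeping] -/
theorem comp3_model_nonneg {B₀ δ₀ B₁ δ₁ : ℝ} (hB₀ : 0 ≤ B₀) (hB₁ : 0 ≤ B₁) (n : Fin 4) (y y' : BlkY i) :
    0 ≤ comp3 (modelK₁ i B₀ δ₀ n) (modelK₂ i B₁ δ₁) (modelK₃ i B₀ δ₀ n) y y' := by
  unfold comp3
  exact Finset.sum_nonneg fun y₁ _ => Finset.sum_nonneg fun y₂ _ =>
    mul_nonneg (mul_nonneg (modelK₁_nonneg hB₀ δ₀ n y y₁) (modelK₂_nonneg hB₁ δ₁ y₁ y₂)) (modelK₃_nonneg hB₀ δ₀ n y₂ y')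

/-- **THE CORE BOUND WITH THE UNITS SEPARATED**: for a functional `Λ` obeying the LEFT schema bound at observation block `y` with `η`-power `eₐ` and
length power `p` (`η^{eₐ}‖Λ(G′Q′*(δ_{y₁}⊗F))‖ ≤ B₀ℓ(y)^{p}e^{…}`) and an input `φ` obeying the RIGHT schema bound at `y′` with `e_b`, `q` (`W(y₂)η^{e_b}‖(Q′G′φ)(y₂)‖
≤ B₀ℓ(y′)^{q}e^{…}`), under the (3.48) schema: `‖Λ(P(U)φ)‖ ≤ (η⁻¹)^{eₐ}·(η⁻¹)^{e_b}·η^{4+d′} · comp3 K₁ K₂ K₃ (y, y′)` with the model kernels.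
[cite: Balaban1985BackgroundPropagators, (3.25) p.394 with (3.42) p.397, (3.48) p.398, (3.49) p.399] -/
theorem norm_apply_P349Y_le_model {B₀ δ₀ B₁ δ₁ : ℝ} (hB₀ : 0 ≤ B₀) (hB₁ : 0 ≤ B₁) (h348 : Blk348At i parS Gp U B₁ δ₁)
    (Λ : (SiteY i → 𝔸) →ₗ[ℂ] 𝔸) (φ : SiteY i → 𝔸) (s s' : BlkY i) (ea eb p q : ℕ)
    (hL : ∀ (s₁ : BlkY i) (F : 𝔸), ‖F‖ ≤ 1 →
      etaS i ^ ea * ‖Λ (Gp U (QpsY i parS U (deltaY s₁ F)))‖ ≤ B₀ * lenB i s ^ p * Real.exp (-(δ₀ * distB i s s₁)))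
    (hR : ∀ s₂ : BlkY i,
      W i.D.toDomains s₂ * (etaS i ^ eb * ‖QpY i parS U (Gp U φ) s₂‖) ≤ B₀ * lenB i s' ^ q * Real.exp (-(δ₀ * distB i s₂ s'))) :
    ‖Λ (P349Y i parS Gp U φ)‖ ≤ (etaS i)⁻¹ ^ ea * (etaS i)⁻¹ ^ eb * etaS i ^ (4 + (d + 1)) *
      comp3 (fun y y₁ => B₀ * lenB i y ^ p * Real.exp (-(δ₀ * distB i y y₁))) (modelK₂ i B₁ δ₁)
        (fun y₂ y'' => B₀ * lenB i y'' ^ q * Real.exp (-(δ₀ * distB i y₂ y''))) s s' := by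
  have hη := etaS_pos i
  have hηa : 0 < etaS i ^ ea := pow_pos hη _
  have hηb : 0 < etaS i ^ eb := pow_pos hη _
  -- the three kernels fed to §2, with the units as factors
  set ℒ : BlkY i → ℝ := fun s₁ => (etaS i ^ ea)⁻¹ * (B₀ * lenB i s ^ p * Real.exp (-(δ₀ * distB i s s₁))) with hℒ
  set 𝒳 : BlkY i → BlkY i → ℝ := fun s₁ s₂ =>
    (cWtY i s₂)⁻¹ * (B₁ * lenB i s₁ ^ (-(4 : ℝ)) * lenB i s₂ ^ (-((d + 1 : ℕ) : ℝ)) * Real.exp (-(δ₁ * distB i s₁ s₂))) with h𝒳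
  set ℛ : BlkY i → ℝ := fun s₂ =>
    (W i.D.toDomains s₂)⁻¹ * ((etaS i ^ eb)⁻¹ * (B₀ * lenB i s' ^ q * Real.exp (-(δ₀ * distB i s₂ s')))) with hℛ
  have hℒ0 : ∀ s₁, 0 ≤ ℒ s₁ := fun s₁ => by
    simp only [hℒ]; have := pow_nonneg (lenB_pos i s).le p; positivity
  have h𝒳0 : ∀ s₁ s₂, 0 ≤ 𝒳 s₁ s₂ := fun s₁ s₂ => by
    simp only [h𝒳]
    have := Real.rpow_nonneg (lenB_pos i s₁).le (-(4 : ℝ))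
    have := Real.rpow_nonneg (lenB_pos i s₂).le (-((d + 1 : ℕ) : ℝ))
    have := (cWtY_pos i s₂).le
    positivity
  have hLℒ : ∀ (s₁ : BlkY i) (F : 𝔸), ‖F‖ ≤ 1 → ‖Λ (Gp U (QpsY i parS U (deltaY s₁ F)))‖ ≤ ℒ s₁ := by
    intro s₁ F hF
    have h1 := hL s₁ F hF
    calc ‖Λ (Gp U (QpsY i parS U (deltaY s₁ F)))‖
        = (etaS i ^ ea)⁻¹ * (etaS i ^ ea * ‖Λ (Gp U (QpsY i parS U (deltaY s₁ F)))‖) := by rw [inv_mul_cancel_left₀ hηa.ne']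
      _ ≤ (etaS i ^ ea)⁻¹ * (B₀ * lenB i s ^ p * Real.exp (-(δ₀ * distB i s s₁))) :=
          mul_le_mul_of_nonneg_left h1 (inv_nonneg.2 hηa.le)
      _ = ℒ s₁ := by simp only [hℒ]
  have hX𝒳 : ∀ (s₁ s₂ : BlkY i) (F : 𝔸), ‖F‖ ≤ 1 → ‖XinvY i parS Gp U (deltaY s₂ F) s₁‖ ≤ 𝒳 s₁ s₂ :=
    fun s₁ s₂ F hF => norm_XinvY_deltaY_le h348 s₁ s₂ F hF
  have hRℛ : ∀ s₂ : BlkY i, ‖QpY i parS U (Gp U φ) s₂‖ ≤ ℛ s₂ := by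
    intro s₂
    have h1 := hR s₂
    have hW := W_pos i.D.toDomains s₂
    calc ‖QpY i parS U (Gp U φ) s₂‖
        = (W i.D.toDomains s₂)⁻¹ * ((etaS i ^ eb)⁻¹ * (W i.D.toDomains s₂ * (etaS i ^ eb * ‖QpY i parS U (Gp U φ) s₂‖))) := by
          field_simp
      _ ≤ (W i.D.toDomains s₂)⁻¹ * ((etaS i ^ eb)⁻¹ * (B₀ * lenB i s' ^ q * Real.exp (-(δ₀ * distB i s₂ s')))) :=
          mul_le_mul_of_nonneg_left (mul_le_mul_of_nonneg_left h1 (inv_nonneg.2 hηb.le)) (inv_nonneg.2 hW.le)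
      _ = ℛ s₂ := by simp only [hℛ]
  have main := norm_apply_P349Y_le Λ φ ℒ 𝒳 ℛ hℒ0 h𝒳0 hLℒ hX𝒳 hRℛ
  refine main.trans (le_of_eq ?_)
  -- bookkeeping of the units: `(cWtY·W)⁻¹ = η^{4+d′}`
  have hcw : ∀ s₂ : BlkY i, (cWtY i s₂)⁻¹ * (W i.D.toDomains s₂)⁻¹ = etaS i ^ (4 + (d + 1)) := fun s₂ => by
    rw [← mul_inv, cWtY_mul_W, inv_pow, inv_inv]
  unfold comp3
  simp only [hℒ, h𝒳, hℛ, modelK₂, Finset.mul_sum]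
  refine Finset.sum_congr rfl fun s₁ _ => Finset.sum_congr rfl fun s₂ _ => ?_
  rw [← hcw s₂, inv_pow, inv_pow]
  ring

/-- ★★★ **THE (3.25)-IN-KERNELS DICTIONARY DISCHARGED OVER THE BLOCKS, PRINT'S UNITS**: under the three block-complete schemas at `U` (`B₀, B₁ ≥ 0`),
every site-sector (3.49) entry of the GENUINE `P(U) = I − R(U)` at every block pair is dominated by the plain double sum of the model kernels —
`fineEntryS i (P349Y i parS Gp) U y y′ n ≤ comp3 K₁ K₂ K₃ y y′`, `K₁(y,y₁) = B₀ℓ(y)^{p_n}e^{−δ₀d(y,y₁)}`, `K₂ = B₁ℓ(y₁)⁻⁴ℓ(y₂)^{−d′}e^{−δ₁d(y₁,y₂)}`, `K₃(y₂,y′) =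
B₀ℓ(y′)^{q_n}e^{−δ₀d(y₂,y′)}` — with NO power of `η` left over (`(η⁻¹)^{d′+#D}·(η⁻¹)^{p}·(η⁻¹)^{q}·η^{4+d′} = 1` since `#D + p + q = 4`).  This is the
`CompDominated ∧ ObservedBy`-content of g0's `B9Ineq349Whole.Dict349` for the genuine letter, as a theorem over `𝔅`; the three-factor power counting
(«using again Lemma 2.1») is the sibling `B9Ineq349SiteFromBlocks`.
[cite: Balaban1985BackgroundPropagators, (3.49) p.399 with (3.25) p.394, (3.42) p.397, (3.48) p.398] -/
theorem fineEntryS_le_comp3_of_schemas {B₀ δ₀ B₁ δ₁ : ℝ} (hB₀ : 0 ≤ B₀) (hB₁ : 0 ≤ B₁)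
    (hLe : Left342At i parS Gp U B₀ δ₀) (hRi : Right342At i parS Gp U B₀ δ₀) (h348 : Blk348At i parS Gp U B₁ δ₁)
    (n : Fin 4) (s s' : BlkY i) :
    fineEntryS i (P349Y i parS Gp) U s s' n ≤ comp3 (modelK₁ i B₀ δ₀ n) (modelK₂ i B₁ δ₁) (modelK₃ i B₀ δ₀ n) s s' := by
  classical
  have hη := etaS_pos i
  have hηinv : 0 ≤ (etaS i)⁻¹ := (inv_pos.2 hη).le
  have hT0 := comp3_model_nonneg (i := i) (δ₀ := δ₀) (δ₁ := δ₁) hB₀ hB₁ n s s'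
  have hTη : 0 ≤ etaS i ^ (d + 1 + dpow349 n) * comp3 (modelK₁ i B₀ δ₀ n) (modelK₂ i B₁ δ₁) (modelK₃ i B₀ δ₀ n) s s' :=
    mul_nonneg (pow_nonneg hη.le _) hT0
  -- the core bound for the admissible `(Λ, φ)` of the entry, units collected: `‖Λ(P φ)‖ ≤ η^{d′+#D}·comp3 …`
  have key : ∀ (Λ : (SiteY i → 𝔸) →ₗ[ℂ] 𝔸) (φ : SiteY i → 𝔸),
      (∀ (s₁ : BlkY i) (F : 𝔸), ‖F‖ ≤ 1 →
        etaS i ^ ea349 n * ‖Λ (Gp U (QpsY i parS U (deltaY s₁ F)))‖ ≤ B₀ * lenB i s ^ ea349 n * Real.exp (-(δ₀ * distB i s s₁))) →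
      (∀ s₂ : BlkY i, W i.D.toDomains s₂ * (etaS i ^ eb349 n * ‖QpY i parS U (Gp U φ) s₂‖) ≤
        B₀ * lenB i s' ^ eb349 n * Real.exp (-(δ₀ * distB i s₂ s'))) →
      ‖Λ (P349Y i parS Gp U φ)‖ ≤ etaS i ^ (d + 1 + dpow349 n) * comp3 (modelK₁ i B₀ δ₀ n) (modelK₂ i B₁ δ₁) (modelK₃ i B₀ δ₀ n) s s' := by
    intro Λ φ hL hR
    have h := norm_apply_P349Y_le_model hB₀ hB₁ h348 Λ φ s s' (ea349 n) (eb349 n) (ea349 n) (eb349 n) hL hR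
    have hunits : (etaS i)⁻¹ ^ ea349 n * (etaS i)⁻¹ ^ eb349 n * etaS i ^ (4 + (d + 1)) = etaS i ^ (d + 1 + dpow349 n) := by
      have hsum : d + 1 + dpow349 n + (ea349 n + eb349 n) = 4 + (d + 1) := by have := e349_sum n; omega
      rw [← hsum, pow_add _ (d + 1 + dpow349 n), ← pow_add, inv_pow, ← mul_assoc, mul_comm _ (etaS i ^ (d + 1 + dpow349 n)),
        mul_assoc, inv_mul_cancel₀ (pow_ne_zero _ hη.ne'), mul_one]
    rw [hunits] at h
    exact h
  -- the inner bound for fixed `E` in the ball and `x′ ∈ B(y′)`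
  unfold fineEntryS
  refine le_trans (mul_le_mul_of_nonneg_left (Real.iSup_le (fun E => Real.iSup_le (fun x' => ?_) hTη) hTη) (pow_nonneg hηinv _)) ?_
  swap
  · rw [← mul_assoc, inv_pow, inv_mul_cancel₀ (pow_ne_zero _ hη.ne'), one_mul]
  have hE : ‖(E : 𝔸)‖ ≤ 1 := mem_closedBall_zero_iff.1 E.2
  have hx' : blkOf i.D.toDomains x'.1 = s' := x'.2
  fin_cases n
  · -- `P(x, x′)`: Λ = evaluation at `z`, φ = `δ_{x′}⊗E`
    show supBlkS i s (P349Y i parS Gp U (deltaY x'.1 (E : 𝔸))) ≤ _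
    refine supBlkS_le i s _ hTη fun z hz => ?_
    exact key (LinearMap.proj z) (deltaY x'.1 (E : 𝔸)) (fun s₁ F hF => (hLe s s₁ F hF z hz).1)
      (fun s₂ => (hRi s₂ s' x'.1 hx' E hE).1)
  · -- `(DP)_μ(x, x′)`: Λ = `∇_{U,μ}` then evaluation at `z`
    show supBlkS' i s (fun μ => cdS i U μ (P349Y i parS Gp U (deltaY x'.1 (E : 𝔸)))) ≤ _
    refine supBlkS'_le i s _ hTη fun z μ hz => ?_
    exact key (LinearMap.proj z ∘ₗ cdSL i U μ) (deltaY x'.1 (E : 𝔸))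
      (fun s₁ F hF => by
        show etaS i ^ 1 * ‖cdS i U μ (Gp U (QpsY i parS U (deltaY s₁ F))) z‖ ≤ B₀ * lenB i s ^ 1 * _
        rw [pow_one, pow_one]; exact (hLe s s₁ F hF z hz).2 μ)
      (fun s₂ => (hRi s₂ s' x'.1 hx' E hE).1)
  · -- `(PD*)_ν(x, x′)`: φ = `∇*_{U,ν}(δ_{x′}⊗E)`
    show (⨆ ν : Fin (d + 1), supBlkS i s (P349Y i parS Gp U (cdsS i U ν (deltaY x'.1 (E : 𝔸))))) ≤ _
    refine Real.iSup_le (fun ν => supBlkS_le i s _ hTη fun z hz => ?_) hTη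
    exact key (LinearMap.proj z) (cdsS i U ν (deltaY x'.1 (E : 𝔸))) (fun s₁ F hF => (hLe s s₁ F hF z hz).1)
      (fun s₂ => by
        show W i.D.toDomains s₂ * (etaS i ^ 1 * ‖QpY i parS U (Gp U (cdsS i U ν (deltaY x'.1 (E : 𝔸)))) s₂‖) ≤ B₀ * lenB i s' ^ 1 * _
        rw [pow_one, pow_one]; exact (hRi s₂ s' x'.1 hx' E hE).2 ν)
  · -- `(DPD*)_{μν}(x, x′)`
    show (⨆ ν : Fin (d + 1), supBlkS' i s (fun μ => cdS i U μ (P349Y i parS Gp U (cdsS i U ν (deltaY x'.1 (E : 𝔸)))))) ≤ _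
    refine Real.iSup_le (fun ν => supBlkS'_le i s _ hTη fun z μ hz => ?_) hTη
    exact key (LinearMap.proj z ∘ₗ cdSL i U μ) (cdsS i U ν (deltaY x'.1 (E : 𝔸)))
      (fun s₁ F hF => by
        show etaS i ^ 1 * ‖cdS i U μ (Gp U (QpsY i parS U (deltaY s₁ F))) z‖ ≤ B₀ * lenB i s ^ 1 * _
        rw [pow_one, pow_one]; exact (hLe s s₁ F hF z hz).2 μ)
      (fun s₂ => by
        show W i.D.toDomains s₂ * (etaS i ^ 1 * ‖QpY i parS U (Gp U (cdsS i U ν (deltaY x'.1 (E : 𝔸)))) s₂‖) ≤ B₀ * lenB i s' ^ 1 * _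
        rw [pow_one, pow_one]; exact (hRi s₂ s' x'.1 hx' E hE).2 ν)

end Discharge

end

end Literature.MathematicalPhysics.QuantumFieldTheory.Balaban1983to89.B9Ineq349SiteComposite
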